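import Literature.Analysis.SegalBargmann.FockStoneGenerator

/-!
# Calculus of Stone generators on the Fock space: `0`, `−X`, `cX`, `UXU⁻¹`, commuting `X, Y`, `X + Y` (after Folland 1989, Ch. 4 §4)

Source followed: G. B. Folland, *Harmonic Analysis in Phase Space*, Ch. 4 §4, cited by item; built on
`FockStoneGenerator`.

Folland Ch. 4 §4 treats `𝒜 ↦ dμ(𝒜) = d/dt μ(e^{t𝒜})|_{t=0}` as a representation of the Lie algebra (Prop (4.43):
"a faithful representation of sp by skew-Hermitian operators on `𝓢`"; Thm (4.45)).  For the compact directions in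
the Fock model, where `FockStoneGenerator` gave the intrinsic description `genDom = {v : the orbit is differentiable
at 0}`, `genOp v = d/dt|₀ ν₀(e^{tX}) v` on the MAXIMAL domains, this file derives the part of that linearity /
equivariance that survives at the level of maximal Stone domains.  Hypotheses are `[Fintype σ] [DecidableEq σ]`,
the displayed `star X = -X` (resp. `star Y = -Y`, and an arbitrary proof of skew-Hermitian-ness of the derived
matrix), and where stated `X * Y = Y * X`; no cited facts.

* (§1) `X = 0`: `genDom = ⊤`, `genOp = 0`;  `−X`: same domain, `genOp(−X) = −genOp(X)`.
* (§2) real rescaling `cX`: `genDom(X) ≤ genDom(cX)` with `genOp(cX) = c·genOp(X)`, and equality of domains for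
  `c ≠ 0`.
* (§3) unitary conjugation: `ν₀(U)` maps `genDom(X)` onto `genDom(UXU*)` and `genOp(UXU*) ∘ ν₀(U) = ν₀(U) ∘ genOp(X)`.
* (§4) commuting directions `XY = YX`: `ν₀(e^{sX})` preserves `genDom(Y)` and commutes with `genOp(Y)`.
* (§5) commuting sum: `genDom(X) ⊓ genDom(Y) ≤ genDom(X+Y)` and there `genOp(X+Y) = genOp(X) + genOp(Y)`
  (the generator of a product of commuting unitary groups; uses the strong continuity of `FockStoneGenerator`).

## What is NOT in this file

Compact directions only; §5 gives the inclusion `⊓ ≤`, not equality of domains (which is false in general); no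
statement for non-commuting `X, Y` beyond conjugation.

## References

* [Folland1989] G. B. Folland, *Harmonic Analysis in Phase Space*, Annals of Mathematics Studies 122, Princeton
  University Press, 1989, Ch. 4 §4 (Prop (4.39), Prop (4.43), Thm (4.45)) (doi:10.1515/9781400882427).

Filed under the LEAN-IN-TREE rule (2026-08-18) by seat pv05-g8 from the HodgeCM/PerL working package file
`HodgeCM/PerL34/FockStoneCalculus.lean` (origin seat pv05-g7); statements and proofs unchanged, namespace
`HodgeCM.PerL34.Fock.Hermite` ↦ `Literature.Analysis.SegalBargmann`.
-/

noncomputable section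

namespace Literature.Analysis.SegalBargmann

open Complex MvPolynomial Matrix NormedSpace Filter Topology
open scoped Real Nat ComplexConjugate InnerProductSpace ENNReal

/- All inner products below are the Hilbert-space ones of `FockL2 σ` (see the note in `FockLadderAdjoint`). -/
attribute [local instance 10000] InnerProductSpace.toInner

variable {σ : Type*} [Fintype σ] [DecidableEq σ]

omit [DecidableEq σ] in
/-- Real scalars act on `𝓕_σ` through `ℂ`. [folklore] -/
private theorem real_smul_eq_coe_smul (r : ℝ) (y : FockL2 σ) : r • y = (r : ℂ) • y :=
  RCLike.real_smul_eq_coe_smul (K := ℂ) r y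

/-- `genDom` only depends on the matrix (any two proofs of skew-Hermitian-ness give the same domain/generator).
[folklore] -/
theorem genDom_congr {X Y : Matrix σ σ ℂ} (hX : star X = -X) (hY : star Y = -Y) (e : X = Y) :
    genDom hX = genDom hY := by
  subst e
  rfl

/-! ## §1  `X = 0` and `−X` -/

/-- `e^{t·0} = 1`. [folklore] -/
theorem expUnitary_zero_matrix (h0 : star (0 : Matrix σ σ ℂ) = -0) (t : ℝ) : expUnitary 0 h0 t = 1 :=
  Subtype.ext (by rw [coe_expUnitary, smul_zero, NormedSpace.exp_zero]; rfl)

/-- The zero direction: every vector is in the domain … [folklore] -/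
theorem genDom_zero_matrix (h0 : star (0 : Matrix σ σ ℂ) = -0) : genDom h0 = ⊤ := by
  refine eq_top_iff.mpr fun v _ => ?_
  rw [mem_genDom_iff_differentiableAt]
  simp only [expUnitary_zero_matrix, map_one, LinearIsometryEquiv.coe_one, id_eq]
  exact differentiableAt_const v

/-- … and the generator vanishes. [folklore] -/
theorem genOp_zero_matrix (h0 : star (0 : Matrix σ σ ℂ) = -0) (v : genDom h0) : genOp h0 v = 0 := by
  have h : HasDerivAt (fun t : ℝ => fockRep (expUnitary 0 h0 t) (v : FockL2 σ)) 0 0 := by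
    simp only [expUnitary_zero_matrix, map_one, LinearIsometryEquiv.coe_one, id_eq]
    exact hasDerivAt_const 0 _
  exact (hasDerivAt_fockRep_expUnitary_genOp h0 v).unique h

/-- `e^{t(−X)} = e^{(−t)X}`. [folklore] -/
theorem expUnitary_neg_matrix {X : Matrix σ σ ℂ} (hX : star X = -X) (h : star (-X) = -(-X)) (t : ℝ) :
    expUnitary (-X) h t = expUnitary X hX (-t) :=
  Subtype.ext (by rw [coe_expUnitary, coe_expUnitary, smul_neg, ← neg_smul, Complex.ofReal_neg])

/-- The orbit of a domain vector under the reversed group has derivative `−genOp v` at `0`.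
[folklore] -/
theorem hasDerivAt_fockRep_expUnitary_neg_matrix {X : Matrix σ σ ℂ} (hX : star X = -X) (h : star (-X) = -(-X))
    (v : genDom hX) :
    HasDerivAt (fun t : ℝ => fockRep (expUnitary (-X) h t) (v : FockL2 σ)) (-genOp hX v) 0 := by
  have h1 := (hasDerivAt_fockRep_expUnitary_genOp hX v).scomp_of_eq (0 : ℝ) (hasDerivAt_neg (0 : ℝ))
    (by rw [neg_zero])
  rw [neg_one_smul] at h1
  exact h1.congr_of_eventuallyEq (Eventually.of_forall fun t => by
    show fockRep (expUnitary (-X) h t) (v : FockL2 σ) = fockRep (expUnitary X hX (-t)) (v : FockL2 σ)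
    rw [expUnitary_neg_matrix hX h])

/-- `−X`: the same domain … [folklore] -/
theorem genDom_neg_matrix {X : Matrix σ σ ℂ} (hX : star X = -X) (h : star (-X) = -(-X)) :
    genDom h = genDom hX := by
  have key : ∀ {Y : Matrix σ σ ℂ} (hY : star Y = -Y) (hY' : star (-Y) = -(-Y)), genDom hY ≤ genDom hY' :=
    fun hY hY' v hv => (mem_genDom_of_hasDerivAt hY' (hasDerivAt_fockRep_expUnitary_neg_matrix hY hY' ⟨v, hv⟩)).1
  refine le_antisymm ?_ (key hX h)
  have h' : star (-(-X)) = -(-(-X)) := by rw [neg_neg]; exact hX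
  calc genDom h ≤ genDom h' := key h h'
    _ = genDom hX := genDom_congr h' hX (neg_neg X)

/-- `genDom(X) ≤ genDom(−X)`. [folklore] -/
theorem mem_genDom_neg_matrix {X : Matrix σ σ ℂ} (hX : star X = -X) (h : star (-X) = -(-X)) (v : genDom hX) :
    (v : FockL2 σ) ∈ genDom h :=
  (mem_genDom_of_hasDerivAt h (hasDerivAt_fockRep_expUnitary_neg_matrix hX h v)).1

/-- … and the opposite generator. [folklore] -/
theorem genOp_neg_matrix {X : Matrix σ σ ℂ} (hX : star X = -X) (h : star (-X) = -(-X)) (v : genDom hX) :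
    genOp h ⟨v, mem_genDom_neg_matrix hX h v⟩ = -genOp hX v :=
  genOp_eq_of_hasDerivAt h (hasDerivAt_fockRep_expUnitary_neg_matrix hX h v)

/-! ## §2  Real rescaling `cX` -/

/-- `e^{t(cX)} = e^{(tc)X}` for real `c`. [folklore] -/
theorem expUnitary_real_smul {X : Matrix σ σ ℂ} (hX : star X = -X) (c : ℝ)
    (h : star ((c : ℂ) • X) = -((c : ℂ) • X)) (t : ℝ) :
    expUnitary ((c : ℂ) • X) h t = expUnitary X hX (t * c) :=
  Subtype.ext (by rw [coe_expUnitary, coe_expUnitary, smul_smul, Complex.ofReal_mul])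

/-- The orbit of a domain vector under the rescaled group has derivative `c·genOp v` at `0`.
[folklore] -/
theorem hasDerivAt_fockRep_expUnitary_real_smul {X : Matrix σ σ ℂ} (hX : star X = -X) (c : ℝ)
    (h : star ((c : ℂ) • X) = -((c : ℂ) • X)) (v : genDom hX) :
    HasDerivAt (fun t : ℝ => fockRep (expUnitary ((c : ℂ) • X) h t) (v : FockL2 σ)) ((c : ℂ) • genOp hX v) 0 := by
  have hc : HasDerivAt (fun t : ℝ => t * c) c 0 := hasDerivAt_mul_const c
  have h1 := (hasDerivAt_fockRep_expUnitary_genOp hX v).scomp_of_eq (0 : ℝ) hc (by rw [zero_mul])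
  rw [real_smul_eq_coe_smul] at h1
  exact h1.congr_of_eventuallyEq (Eventually.of_forall fun t => by
    show fockRep (expUnitary ((c : ℂ) • X) h t) (v : FockL2 σ) = fockRep (expUnitary X hX (t * c)) (v : FockL2 σ)
    rw [expUnitary_real_smul hX c h])

/-- `genDom(X) ≤ genDom(cX)` for every real `c` … [folklore] -/
theorem genDom_le_genDom_real_smul {X : Matrix σ σ ℂ} (hX : star X = -X) (c : ℝ)
    (h : star ((c : ℂ) • X) = -((c : ℂ) • X)) : genDom hX ≤ genDom h :=
  fun v hv => (mem_genDom_of_hasDerivAt h (hasDerivAt_fockRep_expUnitary_real_smul hX c h ⟨v, hv⟩)).1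

/-- … with `genOp(cX) = c · genOp(X)` there … [folklore] -/
theorem genOp_real_smul {X : Matrix σ σ ℂ} (hX : star X = -X) (c : ℝ)
    (h : star ((c : ℂ) • X) = -((c : ℂ) • X)) (v : genDom hX) :
    genOp h ⟨v, genDom_le_genDom_real_smul hX c h v.2⟩ = (c : ℂ) • genOp hX v :=
  genOp_eq_of_hasDerivAt h (hasDerivAt_fockRep_expUnitary_real_smul hX c h v)

/-- … and equality of domains for `c ≠ 0`. [folklore] -/
theorem genDom_real_smul {X : Matrix σ σ ℂ} (hX : star X = -X) {c : ℝ} (hc : c ≠ 0)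
    (h : star ((c : ℂ) • X) = -((c : ℂ) • X)) : genDom h = genDom hX := by
  refine le_antisymm ?_ (genDom_le_genDom_real_smul hX c h)
  have e : ((c⁻¹ : ℝ) : ℂ) • ((c : ℂ) • X) = X := by
    rw [smul_smul, ← Complex.ofReal_mul, inv_mul_cancel₀ hc, Complex.ofReal_one, one_smul]
  have h' : star (((c⁻¹ : ℝ) : ℂ) • ((c : ℂ) • X)) = -(((c⁻¹ : ℝ) : ℂ) • ((c : ℂ) • X)) := by rw [e]; exact hX
  calc genDom h ≤ genDom h' := genDom_le_genDom_real_smul h c⁻¹ h'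
    _ = genDom hX := genDom_congr h' hX e

/-! ## §3  Unitary conjugation `UXU⁻¹` -/

omit [Fintype σ] [DecidableEq σ] in
/-- `U X Uᴴ` is skew-Hermitian when `X` is. [folklore] -/
theorem star_unitary_conj_eq_neg [Fintype σ] [DecidableEq σ] {X : Matrix σ σ ℂ} (hX : star X = -X)
    (U : Matrix.unitaryGroup σ ℂ) :
    star ((U : Matrix σ σ ℂ) * X * star (U : Matrix σ σ ℂ)) = -((U : Matrix σ σ ℂ) * X * star (U : Matrix σ σ ℂ)) := by
  rw [star_mul, star_mul, star_star, hX, neg_mul, mul_neg, Matrix.mul_assoc]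

/-- `e^{t·UXU*} = U e^{tX} U*` at the matrix level … [folklore] -/
theorem coe_expUnitary_unitary_conj {X : Matrix σ σ ℂ} (hX : star X = -X) (U : Matrix.unitaryGroup σ ℂ)
    (h : star ((U : Matrix σ σ ℂ) * X * star (U : Matrix σ σ ℂ)) = -((U : Matrix σ σ ℂ) * X * star (U : Matrix σ σ ℂ)))
    (t : ℝ) :
    (expUnitary ((U : Matrix σ σ ℂ) * X * star (U : Matrix σ σ ℂ)) h t : Matrix σ σ ℂ)
      = (U : Matrix σ σ ℂ) * (expUnitary X hX t : Matrix σ σ ℂ) * star (U : Matrix σ σ ℂ) := by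
  have hU : IsUnit (U : Matrix σ σ ℂ) := ⟨Unitary.toUnits U, rfl⟩
  have hinv : (U : Matrix σ σ ℂ)⁻¹ = star (U : Matrix σ σ ℂ) :=
    Matrix.inv_eq_left_inv (Unitary.coe_star_mul_self _)
  rw [coe_expUnitary, coe_expUnitary, ← Matrix.smul_mul, ← Matrix.mul_smul, ← hinv, Matrix.exp_conj _ _ hU]

/-- … and in the group `U(σ)`. [folklore] -/
theorem expUnitary_unitary_conj {X : Matrix σ σ ℂ} (hX : star X = -X) (U : Matrix.unitaryGroup σ ℂ)
    (h : star ((U : Matrix σ σ ℂ) * X * star (U : Matrix σ σ ℂ)) = -((U : Matrix σ σ ℂ) * X * star (U : Matrix σ σ ℂ)))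
    (t : ℝ) :
    expUnitary ((U : Matrix σ σ ℂ) * X * star (U : Matrix σ σ ℂ)) h t = U * expUnitary X hX t * U⁻¹ :=
  Subtype.ext (by
    rw [Matrix.UnitaryGroup.mul_val, Matrix.UnitaryGroup.mul_val, Matrix.UnitaryGroup.inv_val,
      coe_expUnitary_unitary_conj hX U h])

/-- `ν₀(e^{t·UXU*}) (ν₀(U) v) = ν₀(U) (ν₀(e^{tX}) v)`. [folklore] -/
theorem fockRep_expUnitary_unitary_conj {X : Matrix σ σ ℂ} (hX : star X = -X) (U : Matrix.unitaryGroup σ ℂ)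
    (h : star ((U : Matrix σ σ ℂ) * X * star (U : Matrix σ σ ℂ)) = -((U : Matrix σ σ ℂ) * X * star (U : Matrix σ σ ℂ)))
    (t : ℝ) (v : FockL2 σ) :
    fockRep (expUnitary ((U : Matrix σ σ ℂ) * X * star (U : Matrix σ σ ℂ)) h t) (fockRep U v)
      = fockRep U (fockRep (expUnitary X hX t) v) := by
  rw [expUnitary_unitary_conj hX U h, fockRep_conj_apply]

/-- The orbit of `ν₀(U) v` under the conjugated group has derivative `ν₀(U)(genOp v)` at `0`.
[folklore] -/
theorem hasDerivAt_fockRep_expUnitary_unitary_conj {X : Matrix σ σ ℂ} (hX : star X = -X)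
    (U : Matrix.unitaryGroup σ ℂ)
    (h : star ((U : Matrix σ σ ℂ) * X * star (U : Matrix σ σ ℂ)) = -((U : Matrix σ σ ℂ) * X * star (U : Matrix σ σ ℂ)))
    (v : genDom hX) :
    HasDerivAt (fun t : ℝ => fockRep (expUnitary ((U : Matrix σ σ ℂ) * X * star (U : Matrix σ σ ℂ)) h t)
      (fockRep U (v : FockL2 σ))) (fockRep U (genOp hX v)) 0 := by
  let L : FockL2 σ →L[ℝ] FockL2 σ :=
    ((fockRep U).toContinuousLinearEquiv : FockL2 σ →L[ℂ] FockL2 σ).restrictScalars ℝ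
  have h1 := L.hasFDerivAt.comp_hasDerivAt (0 : ℝ) (hasDerivAt_fockRep_expUnitary_genOp hX v)
  refine h1.congr_of_eventuallyEq (Eventually.of_forall fun t => ?_)
  show fockRep (expUnitary _ h t) (fockRep U (v : FockL2 σ)) = L (fockRep (expUnitary X hX t) (v : FockL2 σ))
  rw [fockRep_expUnitary_unitary_conj hX U h]
  rfl

/-- `ν₀(U)` maps `genDom(X)` into `genDom(UXU*)` … [folklore] -/
theorem fockRep_mem_genDom_unitary_conj {X : Matrix σ σ ℂ} (hX : star X = -X) (U : Matrix.unitaryGroup σ ℂ)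
    (h : star ((U : Matrix σ σ ℂ) * X * star (U : Matrix σ σ ℂ)) = -((U : Matrix σ σ ℂ) * X * star (U : Matrix σ σ ℂ)))
    (v : genDom hX) : fockRep U (v : FockL2 σ) ∈ genDom h :=
  (mem_genDom_of_hasDerivAt h (hasDerivAt_fockRep_expUnitary_unitary_conj hX U h v)).1

/-- … intertwining the generators: `genOp(UXU*) (ν₀(U) v) = ν₀(U) (genOp(X) v)` … [folklore] -/
theorem genOp_unitary_conj {X : Matrix σ σ ℂ} (hX : star X = -X) (U : Matrix.unitaryGroup σ ℂ)
    (h : star ((U : Matrix σ σ ℂ) * X * star (U : Matrix σ σ ℂ)) = -((U : Matrix σ σ ℂ) * X * star (U : Matrix σ σ ℂ)))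
    (v : genDom hX) :
    genOp h ⟨fockRep U (v : FockL2 σ), fockRep_mem_genDom_unitary_conj hX U h v⟩ = fockRep U (genOp hX v) :=
  genOp_eq_of_hasDerivAt h (hasDerivAt_fockRep_expUnitary_unitary_conj hX U h v)

/-- … and ONTO: `ν₀(U) v ∈ genDom(UXU*) ↔ v ∈ genDom(X)`. [folklore] -/
theorem fockRep_mem_genDom_unitary_conj_iff {X : Matrix σ σ ℂ} (hX : star X = -X) (U : Matrix.unitaryGroup σ ℂ)
    (h : star ((U : Matrix σ σ ℂ) * X * star (U : Matrix σ σ ℂ)) = -((U : Matrix σ σ ℂ) * X * star (U : Matrix σ σ ℂ)))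
    (v : FockL2 σ) : fockRep U v ∈ genDom h ↔ v ∈ genDom hX := by
  refine ⟨fun hv => ?_, fun hv => fockRep_mem_genDom_unitary_conj hX U h ⟨v, hv⟩⟩
  rw [mem_genDom_iff_differentiableAt] at hv ⊢
  let L : FockL2 σ ≃L[ℝ] FockL2 σ := ((fockRep U).symm.toContinuousLinearEquiv).restrictScalars ℝ
  have hfun : (fun t : ℝ => fockRep (expUnitary X hX t) v)
      = L ∘ fun t : ℝ => fockRep (expUnitary ((U : Matrix σ σ ℂ) * X * star (U : Matrix σ σ ℂ)) h t) (fockRep U v) := by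
    funext t
    show _ = (fockRep U).symm (fockRep (expUnitary _ h t) (fockRep U v))
    rw [fockRep_expUnitary_unitary_conj hX U h, LinearIsometryEquiv.symm_apply_apply]
  rw [hfun, L.comp_differentiableAt_iff]
  exact hv

/-! ## §4  Commuting directions -/

/-- Commuting directions give commuting one-parameter groups: `e^{sX} e^{tY} = e^{tY} e^{sX}`.
[folklore] -/
theorem expUnitary_mul_comm {X Y : Matrix σ σ ℂ} (hX : star X = -X) (hY : star Y = -Y) (hc : X * Y = Y * X)
    (s t : ℝ) : expUnitary X hX s * expUnitary Y hY t = expUnitary Y hY t * expUnitary X hX s :=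
  Subtype.ext (by
    rw [Matrix.UnitaryGroup.mul_val, Matrix.UnitaryGroup.mul_val, coe_expUnitary, coe_expUnitary]
    exact ((((show Commute X Y from hc).smul_left (s : ℂ)).smul_right (t : ℂ)).exp_left.exp_right).eq)

/-- Commuting one-parameter groups commute on `𝓕_σ`. [folklore] -/
theorem fockRep_expUnitary_comm_apply {X Y : Matrix σ σ ℂ} (hX : star X = -X) (hY : star Y = -Y)
    (hc : X * Y = Y * X) (s t : ℝ) (v : FockL2 σ) :
    fockRep (expUnitary X hX s) (fockRep (expUnitary Y hY t) v)
      = fockRep (expUnitary Y hY t) (fockRep (expUnitary X hX s) v) := by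
  have h := congrArg (fun W => fockRep W v) (expUnitary_mul_comm hX hY hc s t)
  simpa only [map_mul, LinearIsometryEquiv.coe_mul, Function.comp_apply] using h

/-- For commuting `X, Y`: `d/dt|₀ ν₀(e^{tY}) ν₀(e^{sX}) v = ν₀(e^{sX}) (genOp(Y) v)`. [folklore] -/
theorem hasDerivAt_fockRep_expUnitary_of_commute {X Y : Matrix σ σ ℂ} (hX : star X = -X) (hY : star Y = -Y)
    (hc : X * Y = Y * X) (s : ℝ) (v : genDom hY) :
    HasDerivAt (fun t : ℝ => fockRep (expUnitary Y hY t) (fockRep (expUnitary X hX s) (v : FockL2 σ)))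
      (fockRep (expUnitary X hX s) (genOp hY v)) 0 := by
  let L : FockL2 σ →L[ℝ] FockL2 σ :=
    ((fockRep (expUnitary X hX s)).toContinuousLinearEquiv : FockL2 σ →L[ℂ] FockL2 σ).restrictScalars ℝ
  have h1 := L.hasFDerivAt.comp_hasDerivAt (0 : ℝ) (hasDerivAt_fockRep_expUnitary_genOp hY v)
  refine h1.congr_of_eventuallyEq (Eventually.of_forall fun t => ?_)
  show fockRep (expUnitary Y hY t) (fockRep (expUnitary X hX s) (v : FockL2 σ))
    = L (fockRep (expUnitary Y hY t) (v : FockL2 σ))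
  rw [← fockRep_expUnitary_comm_apply hX hY hc]
  rfl

/-- For commuting `X, Y`: `ν₀(e^{sX})` preserves `genDom(Y)` … [folklore] -/
theorem fockRep_expUnitary_mem_genDom_of_commute {X Y : Matrix σ σ ℂ} (hX : star X = -X) (hY : star Y = -Y)
    (hc : X * Y = Y * X) (s : ℝ) (v : genDom hY) :
    fockRep (expUnitary X hX s) (v : FockL2 σ) ∈ genDom hY :=
  (mem_genDom_of_hasDerivAt hY (hasDerivAt_fockRep_expUnitary_of_commute hX hY hc s v)).1

/-- … and commutes with `genOp(Y)`. [folklore] -/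
theorem genOp_fockRep_expUnitary_of_commute {X Y : Matrix σ σ ℂ} (hX : star X = -X) (hY : star Y = -Y)
    (hc : X * Y = Y * X) (s : ℝ) (v : genDom hY) :
    genOp hY ⟨fockRep (expUnitary X hX s) (v : FockL2 σ), fockRep_expUnitary_mem_genDom_of_commute hX hY hc s v⟩
      = fockRep (expUnitary X hX s) (genOp hY v) :=
  genOp_eq_of_hasDerivAt hY (hasDerivAt_fockRep_expUnitary_of_commute hX hY hc s v)

/-! ## §5  The commuting sum `X + Y` -/

/-- For commuting `X, Y`: `e^{t(X+Y)} = e^{tX} e^{tY}`. [folklore] -/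
theorem expUnitary_add_of_commute {X Y : Matrix σ σ ℂ} (hX : star X = -X) (hY : star Y = -Y)
    (hc : X * Y = Y * X) (h : star (X + Y) = -(X + Y)) (t : ℝ) :
    expUnitary (X + Y) h t = expUnitary X hX t * expUnitary Y hY t :=
  Subtype.ext (by
    rw [Matrix.UnitaryGroup.mul_val, coe_expUnitary, coe_expUnitary, coe_expUnitary, smul_add]
    exact Matrix.exp_add_of_commute _ _ (((show Commute X Y from hc).smul_left (t : ℂ)).smul_right (t : ℂ)))

/-- Joint continuity at `t = 0`: if `a(t) → b` as `t → 0`, `t ≠ 0`, then `ν₀(e^{tX}) a(t) → b` (isometry + strong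
continuity of `FockStoneGenerator`). [folklore] -/
theorem tendsto_fockRep_expUnitary_apply_of_tendsto {X : Matrix σ σ ℂ} (hX : star X = -X) {a : ℝ → FockL2 σ}
    {b : FockL2 σ} (ha : Tendsto a (𝓝[≠] 0) (𝓝 b)) :
    Tendsto (fun t : ℝ => fockRep (expUnitary X hX t) (a t)) (𝓝[≠] 0) (𝓝 b) := by
  rw [tendsto_iff_norm_sub_tendsto_zero] at ha ⊢
  have h2 : Tendsto (fun t : ℝ => ‖fockRep (expUnitary X hX t) b - b‖) (𝓝[≠] 0) (𝓝 0) := by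
    have h := (tendsto_fockRep_expUnitary_zero hX b).mono_left (nhdsWithin_le_nhds (s := {(0 : ℝ)}ᶜ))
    rw [tendsto_iff_norm_sub_tendsto_zero] at h
    exact h
  have hsum := ha.add h2
  rw [add_zero] at hsum
  refine squeeze_zero (fun t => norm_nonneg _) (fun t => ?_) hsum
  calc ‖fockRep (expUnitary X hX t) (a t) - b‖
      ≤ ‖fockRep (expUnitary X hX t) (a t) - fockRep (expUnitary X hX t) b‖ + ‖fockRep (expUnitary X hX t) b - b‖ :=
        norm_sub_le_norm_sub_add_norm_sub _ _ _
    _ = ‖a t - b‖ + ‖fockRep (expUnitary X hX t) b - b‖ := by rw [← map_sub, LinearIsometryEquiv.norm_map]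

/-- **The generator of a product of commuting groups is the sum of the generators**, on `genDom(X) ⊓ genDom(Y)`.
[folklore] -/
theorem hasDerivAt_fockRep_expUnitary_add_of_commute {X Y : Matrix σ σ ℂ} (hX : star X = -X) (hY : star Y = -Y)
    (hc : X * Y = Y * X) (h : star (X + Y) = -(X + Y)) {v : FockL2 σ} (hvX : v ∈ genDom hX) (hvY : v ∈ genDom hY) :
    HasDerivAt (fun t : ℝ => fockRep (expUnitary (X + Y) h t) v) (genOp hX ⟨v, hvX⟩ + genOp hY ⟨v, hvY⟩) 0 := by
  have hXd := hasDerivAt_fockRep_expUnitary_genOp hX ⟨v, hvX⟩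
  have hYd := hasDerivAt_fockRep_expUnitary_genOp hY ⟨v, hvY⟩
  rw [hasDerivAt_iff_tendsto_slope_zero] at hXd hYd ⊢
  simp only [zero_add, expUnitary_zero, map_one, LinearIsometryEquiv.coe_one, id_eq, real_smul_eq_coe_smul]
    at hXd hYd ⊢
  have h1 := tendsto_fockRep_expUnitary_apply_of_tendsto hX hYd
  refine (hXd.add h1).congr fun t => ?_
  rw [expUnitary_add_of_commute hX hY hc h t, map_mul, LinearIsometryEquiv.coe_mul, Function.comp_apply,
    LinearIsometryEquiv.map_smul, map_sub, ← smul_add]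
  congr 1
  abel

/-- `genDom(X) ⊓ genDom(Y) ≤ genDom(X + Y)` for commuting `X, Y` … [folklore] -/
theorem inf_genDom_le_genDom_add_of_commute {X Y : Matrix σ σ ℂ} (hX : star X = -X) (hY : star Y = -Y)
    (hc : X * Y = Y * X) (h : star (X + Y) = -(X + Y)) : genDom hX ⊓ genDom hY ≤ genDom h :=
  fun _ hv => (mem_genDom_of_hasDerivAt h (hasDerivAt_fockRep_expUnitary_add_of_commute hX hY hc h hv.1 hv.2)).1

/-- … and there `genOp(X + Y) = genOp(X) + genOp(Y)`. [folklore] -/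
theorem genOp_add_of_commute {X Y : Matrix σ σ ℂ} (hX : star X = -X) (hY : star Y = -Y)
    (hc : X * Y = Y * X) (h : star (X + Y) = -(X + Y)) {v : FockL2 σ} (hvX : v ∈ genDom hX) (hvY : v ∈ genDom hY) :
    genOp h ⟨v, inf_genDom_le_genDom_add_of_commute hX hY hc h ⟨hvX, hvY⟩⟩
      = genOp hX ⟨v, hvX⟩ + genOp hY ⟨v, hvY⟩ :=
  genOp_eq_of_hasDerivAt h (hasDerivAt_fockRep_expUnitary_add_of_commute hX hY hc h hvX hvY)

end Literature.Analysis.SegalBargmann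

end
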